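import Summits.FinalStateConjecture.FinalStateConjecture.Theorems.ZeroEnergyKerrOrBombZeroEnergyRigidityStubKerrChartTransfer
import Summits.FinalStateConjecture.FinalStateConjecture.Theorems.ZeroEnergyKerrOrBombZeroEnergyRigidityStubNonRotatingUniqueness
import Summits.FinalStateConjecture.FinalStateConjecture.Theorems.ZeroEnergyKerrOrBombHawkingExtensionIsKerrStubHorizonKillingOfNonrotating
import Summits.FinalStateConjecture.FinalStateConjecture.Theorems.ZeroEnergyKerrOrBombHawkingExtensionIsKerrStubAxialCollarNeZero
import Summits.FinalStateConjecture.FinalStateConjecture.Theorems.ZeroEnergyKerrOrBombHawkingExtensionIsKerrStubAxialCollarPrep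
import Summits.FinalStateConjecture.FinalStateConjecture.Theorems.ZeroEnergyKerrOrBombHawkingExtensionIsKerrStubDocCompleteOfAxial
import Summits.FinalStateConjecture.FinalStateConjecture.Theorems.ZeroEnergyKerrOrBombHawkingExtensionIsKerrStubCollarNullTangent
import Literature.Geometry.Lorentzian.NonRotatingBlackHoleUniqueness
import Literature.Geometry.Lorentzian.DocAxisymmetricUniqueness
import Literature.Geometry.Lorentzian.EventHorizonSurfaceGravity
import Literature.Geometry.Lorentzian.DocAxisymmetricSpacetime
import Literature.Geometry.Lorentzian.LorentzianMetricProofs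
import Literature.Geometry.Lorentzian.CausalityOpennessProofs

/-!
# Crux `HawkingExtensionIsKerr` (stmt-FinalStateConjecture-17840), line `SketchIdeator2` — the crux over the vendored facts

Helper file of the line lead (prover-line-stmt-FinalStateConjecture-17840-0), registered sub-goal
`hawkingExtensionIsKerr_of_facts` of the crux item: the registered skeleton
`Cruxes/HawkingExtensionIsKerr/Lines/SketchIdeator2.lean` (reshape r2) with EVERY provable stub landed
(`stub_horizonKilling_of_nonrotating` p135609, `stub_axialCollar_ne_zero` p135938,
`stub_axialCollar_prep` p136216, `stub_docComplete_of_axial` p137129, `stub_collarNullTangent`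
p137947), written as one sorry-free CONDITIONAL theorem: the body of
`Theses.ZeroEnergyKerrOrBomb.HawkingExtensionIsKerr` (rev 9, verbatim) from the six Literature named
facts it rests on —

* `VacuumHorizonZerothLaw`, `DegenerateVacuumHorizonNoCollar`
  (`Literature/Geometry/Lorentzian/EventHorizonSurfaceGravity.lean`: zeroth law of black-hole
  mechanics and the near-horizon Gauss–Bonnet obstruction, consequence form);
* `SudarskyWald1993_staticity`, `ChruscielGalloway2010_docStaticUniqueness`
  (`NonRotatingBlackHoleUniqueness.lean`: the non-rotating branch);
* `Chrusciel1997_docAxisymmetricCombination`, `ChruscielCostaHeusler2012_docAxisymmetricUniqueness`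
  (`DocAxisymmetricUniqueness.lean`: the rotating branch at d.o.c. level).

Proof (= the skeleton's `HawkingExtensionIsKerr_of`): the collar field `K` is null and locally
tangent on `𝓔⁺` (P5, using completeness of `K'` inside the d.o.c.: P4 in the rotating branch,
`docComplete_of_nonrotating` otherwise), so the zeroth law gives `∇_K K = κ K` with one constant
`κ`, non-zero by the Gauss–Bonnet obstruction against the timelike collar (`collarSurfaceGravity_of`);
then the dichotomy `K' ∈ ℝ T` on the d.o.c. or not: Sudarsky–Wald + static uniqueness (P1 moves the
`κ`-clause to `T`), or Chruściel 1997 + CCH12 Thm 3.2 at d.o.c. level (P2, P3 prepare the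
axisymmetric data and the rescaled horizon field); chart form by `stub_kerrChartTransfer` (p80091).

References: Chruściel–Costa–Heusler, Living Rev. Relativity 15 (2012) 7, §3; Chruściel, Commun.
Math. Phys. 189 (1997) 1; Chruściel–Costa, arXiv:0806.0016, §4, §7; Wald, General Relativity
(1984), §12.5; Kunduri–Lucietti, Living Rev. Relativity 16 (2013) 8, §2–3.
-/

noncomputable section

set_option linter.dupNamespace false

namespace Summit.FinalStateConjecture.FinalStateConjecture.Theorems.HawkingExtensionIsKerr.SketchIdeator2

open Set Function Literature.Geometry.Lorentzian
open scoped Manifold ContDiff Topology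

/-- An integral curve of `V` along which `V` and `W` agree is an integral curve of `W`. -/
theorem isMIntegralCurve_congr_field {𝓑 : StationaryAFBlackHole.{0}}
    {V W : Π x : 𝓑.carrier, TangentSpace (𝓡 4) x} {γ : ℝ → 𝓑.carrier}
    (hγ : IsMIntegralCurve γ V) (h : ∀ t, V (γ t) = W (γ t)) : IsMIntegralCurve γ W := by
  intro t
  have := hγ t
  rw [h t] at this
  exact this

/-- **In the non-rotating branch `K' = c • T` is complete inside the d.o.c.**: the d.o.c. is
invariant under the complete stationary flow (`mem_doc_of_isMIntegralCurve_of_mlieBracket_eq_zero`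
at `K = T`) and `t ↦ θ(ct)` is the required curve. -/
theorem docComplete_of_nonrotating (𝓑 : StationaryAFBlackHole.{0}) [𝓑.metric.HasLeviCivita]
    {K' : Π x : 𝓑.carrier, TangentSpace (𝓡 4) x} {c : ℝ}
    (hc : ∀ x ∈ 𝓑.doc, K' x = c • 𝓑.killing x) :
    ∀ x ∈ 𝓑.doc, ∃ δ : ℝ → 𝓑.carrier, IsMIntegralCurve δ K' ∧ δ 0 = x ∧ ∀ t, δ t ∈ 𝓑.doc := by
  intro x hx
  obtain ⟨θ, hθ, hθ0⟩ := 𝓑.isStationaryKilling.isCompleteVectorField x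
  have hmem : ∀ t, θ t ∈ 𝓑.doc := fun t ↦
    StationaryAFBlackHole.mem_doc_of_isMIntegralCurve_of_mlieBracket_eq_zero
      𝓑.isStationaryKilling.isKillingField 𝓑.isStationaryKilling.isCompleteVectorField
      (fun y ↦ by simp only [VectorField.mlieBracket_self, Pi.zero_apply]) hθ (hθ0 ▸ hx) t
  refine ⟨θ ∘ (· * c), ?_, by simp [hθ0], fun t ↦ hmem _⟩
  refine isMIntegralCurve_congr_field (hθ.comp_mul c) fun t ↦ ?_
  change (c • 𝓑.killing) (θ (t * c)) = K' (θ (t * c))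
  rw [hc _ (hmem _)]
  rfl

/-- **Card B assembled: the collar has non-zero surface gravity** (sorry-free over P5, the two
named-fact debts and the d.o.c.-completeness of `K'`).  `K` is null and locally tangent on `𝓔⁺`
(P5); the zeroth law gives `∇_K K = κ K` on `𝓔⁺` with one constant `κ`; if `κ = 0` the horizon is
degenerate and the near-horizon Gauss–Bonnet lemma produces a point of `U ∩ ⟨⟨M_ext⟩⟩` where `K`
is spacelike, contradicting the collar sign clause. -/
theorem collarSurfaceGravity_of (hZ : VacuumHorizonZerothLaw)
    (hGB : DegenerateVacuumHorizonNoCollar) (𝓑 : StationaryAFBlackHole.{0})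
    [𝓑.metric.HasLeviCivita] (hvac : 𝓑.metric.toPseudoRiemannianMetric.IsRicciFlat)
    (hreg : 𝓑.IsIPlusRegular)
    (hfut : ∀ p : 𝓑.carrier, p ∈ 𝓑.metric.chronologicalFuture 𝓑.timeOrientation 𝓑.Mext)
    (hsc : SimplyConnectedSpace 𝓑.doc) {U U' : Set 𝓑.carrier}
    {K K' : Π x : 𝓑.carrier, TangentSpace (𝓡 4) x} (hU : IsOpen U) (hHU : 𝓑.horizon ⊆ U)
    (hconn : IsConnected 𝓑.horizon) (hKon : 𝓑.metric.toPseudoRiemannianMetric.IsKillingFieldOn K U)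
    (hKc : ∀ x ∈ U, VectorField.mlieBracket (𝓡 4) 𝓑.killing K x = 0)
    (hKne : ∀ p ∈ 𝓑.horizon, K p ≠ 0)
    (hKtl : ∀ x ∈ U ∩ 𝓑.doc, 𝓑.metric.val x (K x) (K x) < 0)
    (hU' : IsOpen U') (hHU' : 𝓑.horizon ⊆ U') (hK'K : ∀ x ∈ U' ∩ 𝓑.doc, K' x = K x)
    (hK'on : 𝓑.metric.toPseudoRiemannianMetric.IsKillingFieldOn K' 𝓑.doc)
    (hK'comp : ∀ x ∈ 𝓑.doc, ∃ δ : ℝ → 𝓑.carrier, IsMIntegralCurve δ K' ∧ δ 0 = x ∧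
      ∀ t, δ t ∈ 𝓑.doc) :
    ∃ κ : ℝ, κ ≠ 0 ∧ ∀ p ∈ 𝓑.horizon, 𝓑.metric.leviCivita K p (K p) = κ • K p := by
  have hNT := stub_collarNullTangent 𝓑 hfut U U' K K' hU hHU hKon hKtl hU' hHU' hK'K hK'on hK'comp
  have hnull : ∀ p ∈ 𝓑.horizon, 𝓑.metric.val p (K p) (K p) = 0 := fun p hp ↦ (hNT p hp).1
  have htan : ∀ p ∈ 𝓑.horizon, ∃ ε > (0 : ℝ), ∃ γ : ℝ → 𝓑.carrier, γ 0 = p ∧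
      IsMIntegralCurveOn γ K (Set.Ioo (-ε) ε) ∧ ∀ t ∈ Set.Ioo (-ε) ε, γ t ∈ 𝓑.horizon :=
    fun p hp ↦ (hNT p hp).2
  obtain ⟨κ, hκ⟩ := hZ 𝓑 hvac hreg hconn U K hU hHU hKon hKc hKne hnull htan
  refine ⟨κ, ?_, hκ⟩
  rintro rfl
  obtain ⟨x, hx, hpos⟩ := hGB 𝓑 hvac hreg hconn hsc U K hU hHU hKon hKc hKne hnull htan
    (fun p hp ↦ by rw [hκ p hp, zero_smul]) U hU hHU
  exact absurd (hKtl x hx) (not_lt.mpr hpos.le)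

/-! Stubs P1 `stub_horizonKilling_of_nonrotating` (p135609), P2 `stub_axialCollar_ne_zero` (p135938)
and P3 `stub_axialCollar_prep` (p136216) are LANDED (imported above, same namespace). -/

/-! ## The non-rotating endgame over the vendored facts (sorry-free) -/

/-- **Non-rotating endgame.**  Sudarsky–Wald staticity and static uniqueness of a static d.o.c.
give the chart-form Kerr conclusion (with `a = 0`) for a vacuum `I⁺`-regular hole with connected
horizon on which `T ≠ 0` and `∇_T T = κ T`, `κ ≠ 0`.  CCH12 §3.3.1 with Thm 3.1; chart transfer
p80091. -/
theorem kerrConclusion_of_nonrotating (h₁ : SudarskyWald1993_staticity)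
    (h₂ : ChruscielGalloway2010_docStaticUniqueness) (𝓑 : StationaryAFBlackHole.{0})
    [𝓑.metric.HasLeviCivita] [Kerr.Facts] (hvac : 𝓑.metric.toPseudoRiemannianMetric.IsRicciFlat)
    (hreg : 𝓑.IsIPlusRegular) (hconn : IsConnected 𝓑.horizon)
    (hne : ∀ p ∈ 𝓑.horizon, 𝓑.killing p ≠ 0)
    (hκ : ∃ κ : ℝ, κ ≠ 0 ∧ ∀ p ∈ 𝓑.horizon,
      𝓑.metric.leviCivita 𝓑.killing p (𝓑.killing p) = κ • 𝓑.killing p) :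
    ∃ (M a : ℝ), Kerr.IsSubextremal M a ∧ ∃ Ψ : Kerr.exterior M a → 𝓑.carrier,
      Function.Injective Ψ ∧ Set.range Ψ = 𝓑.doc ∧
        PseudoRiemannianMetric.IsIsometricImmersion
          (Kerr.smoothMetric M a (Kerr.rPlus M a)).toPseudoRiemannianMetric
          𝓑.metric.toPseudoRiemannianMetric Ψ := by
  have hstat : 𝓑.metric.toPseudoRiemannianMetric.IsHypersurfaceOrthogonalOn 𝓑.killing 𝓑.doc :=
    h₁ 𝓑 hreg hvac hconn.nonempty hne hκ
  exact ZeroEnergyRigidity.GlobalHorizonKillingField.KerrChartTransfer.stub_kerrChartTransfer 𝓑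
    ((h₂ 𝓑 LorentzianMetric.isOpen_chronologicalFuture_holds_of_boundaryless
      LorentzianMetric.isOpen_chronologicalPast_holds_of_boundaryless
      PseudoRiemannianMetric.contMDiff_restrict_holds hreg hstat hvac
      hconn.nonempty).isIsometricToKerrExterior)


/-- **The crux over the vendored facts (registered sub-goal `hawkingExtensionIsKerr_of_facts`).**
The body of `ZeroEnergyKerrOrBomb.HawkingExtensionIsKerr` (rev 9), verbatim, from the six named
facts; all glue is landed. -/
theorem hawkingExtensionIsKerr_of_facts :
    VacuumHorizonZerothLaw → DegenerateVacuumHorizonNoCollar → SudarskyWald1993_staticity → ChruscielGalloway2010_docStaticUniqueness → Chrusciel1997_docAxisymmetricCombination → ChruscielCostaHeusler2012_docAxisymmetricUniqueness → ∀ (𝓑 : Literature.Geometry.Lorentzian.StationaryAFBlackHole.{0}) [𝓑.metric.HasLeviCivita] [Literature.Geometry.Lorentzian.Kerr.Facts], 𝓑.metric.toPseudoRiemannianMetric.IsRicciFlat → 𝓑.IsIPlusRegular → (∀ p : 𝓑.carrier, p ∈ 𝓑.metric.chronologicalFuture 𝓑.timeOrientation 𝓑.Mext) → (∀ p ∈ 𝓑.doc,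 𝓑.killing p ≠ 0) → SimplyConnectedSpace 𝓑.doc → ∀ (U : Set 𝓑.carrier) (K : Π x : 𝓑.carrier, TangentSpace (𝓡 4) x), IsOpen U → 𝓑.horizon ⊆ U → IsConnected 𝓑.horizon → ContMDiffOn (𝓡 4) ((𝓡 4).prod 𝓘(ℝ, Literature.Geometry.Lorentzian.E4)) ((⊤ : ℕ∞) : WithTop ℕ∞) (fun x ↦ (Bundle.TotalSpace.mk' Literature.Geometry.Lorentzian.E4 x (K x) : TangentBundle (𝓡 4) 𝓑.carrier)) U → (∀ x ∈ U, ∀ v w : TangentSpace (𝓡 4) x, 𝓑.metric.val x (𝓑.metric.leviCivita K x v) w + 𝓑.metric.val x v (𝓑.metric.leviCivita K x w) = 0) → (∀ x ∈ U, VectorField.mlieBracket (𝓡 4) 𝓑.killing K x = 0) → (∀ p ∈ 𝓑.horizon, K p ≠ 0) → (∀ γ : ℝ → 𝓑.carrier, IsMIntegralCurve γ K → γ 0 ∈ 𝓑.horizon → ∀ t, γ t ∈ 𝓑.horizon) → (∀ x ∈ U ∩ 𝓑.doc, 𝓑.metric.val x (K x) (K x) < 0) → (∃ K' : Π x : 𝓑.carrier,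 TangentSpace (𝓡 4) x, ContMDiffOn (𝓡 4) ((𝓡 4).prod 𝓘(ℝ, Literature.Geometry.Lorentzian.E4)) ((⊤ : ℕ∞) : WithTop ℕ∞) (fun x ↦ (Bundle.TotalSpace.mk' Literature.Geometry.Lorentzian.E4 x (K' x) : TangentBundle (𝓡 4) 𝓑.carrier)) 𝓑.doc ∧ (∀ x ∈ 𝓑.doc, ∀ v w : TangentSpace (𝓡 4) x, 𝓑.metric.val x (𝓑.metric.leviCivita K' x v) w + 𝓑.metric.val x v (𝓑.metric.leviCivita K' x w) = 0) ∧ (∀ x ∈ 𝓑.doc, VectorField.mlieBracket (𝓡 4) 𝓑.killing K' x = 0) ∧ ∃ U' : Set 𝓑.carrier, IsOpen U' ∧ 𝓑.horizon ⊆ U' ∧ ∀ x ∈ U' ∩ 𝓑.doc, K' x = K x) → ∃ (M a : ℝ), Literature.Geometry.Lorentzian.Kerr.IsSubextremal M a ∧ ∃ Ψ : Literature.Geometry.Lorentzian.Kerr.exterior M a → 𝓑.carrier, Function.Injective Ψ ∧ Set.range Ψ = 𝓑.doc ∧ Literature.Geometry.Lorentzian.PseudoRiemannianMetric.IsIsometricImmersion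 (Literature.Geometry.Lorentzian.Kerr.smoothMetric M a (Literature.Geometry.Lorentzian.Kerr.rPlus M a)).toPseudoRiemannianMetric 𝓑.metric.toPseudoRiemannianMetric Ψ := by
  intro hZ hGB h₁ h₂ hCh97 hCCH 𝓑 _ _ hvac hreg hfut hT hsc U K hU hHU hconn hKs hKk hKc hKne hKtan hKtl hext
  obtain ⟨K', hK's, hK'k, hK'c, U', hU', hHU', hK'K⟩ := hext
  have hKon : 𝓑.metric.toPseudoRiemannianMetric.IsKillingFieldOn K U := ⟨hKs, hKk⟩
  have hK'on : 𝓑.metric.toPseudoRiemannianMetric.IsKillingFieldOn K' 𝓑.doc := ⟨hK's, hK'k⟩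
  classical
  by_cases hrot : ∃ c : ℝ, ∀ x ∈ 𝓑.doc, K' x = c • 𝓑.killing x
  · -- non-rotating branch
    obtain ⟨c, hc⟩ := hrot
    obtain ⟨κ, hκ, hκK⟩ := collarSurfaceGravity_of hZ hGB 𝓑 hvac hreg hfut hsc hU hHU hconn hKon hKc
      hKne hKtl hU' hHU' hK'K hK'on (docComplete_of_nonrotating 𝓑 hc)
    obtain ⟨hc0, hTne, hTκ⟩ := stub_horizonKilling_of_nonrotating 𝓑 U U' K K' c κ hU hHU hKon hU'
      hHU' hK'K hc hKne hκK hconn.nonempty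
    exact kerrConclusion_of_nonrotating h₁ h₂ 𝓑 hvac hreg hconn hTne
      ⟨c⁻¹ * κ, mul_ne_zero (inv_ne_zero hc0) hκ, hTκ⟩
  · -- rotating branch
    obtain ⟨a, b, hb, hper, hax⟩ := hCh97 𝓑 hvac hreg hconn hsc K' hK'on hK'c hrot
    obtain ⟨κ, hκ, hκK⟩ := collarSurfaceGravity_of hZ hGB 𝓑 hvac hreg hfut hsc hU hHU hconn hKon hKc
      hKne hKtl hU' hHU' hK'K hK'on (stub_docComplete_of_axial 𝓑 K' a b hreg hK'on hK'c hb hper)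
    have ha : a ≠ 0 := stub_axialCollar_ne_zero 𝓑 U U' K K' a b hreg hconn hU hHU hKon hKtl hU'
      hHU' hK'K hK'on hb hper
    obtain ⟨hΦon, hΦc, hΦnt, hUU', hHUU', hχon, hχeq, hχne, hχtan, hκ', hχκ⟩ :=
      stub_axialCollar_prep 𝓑 U U' K K' a b κ hU hHU hKon hKc hKne hKtan hU' hHU' hK'K hK'on hK'c
        hrot ha hb hκ hκK
    exact ZeroEnergyRigidity.GlobalHorizonKillingField.KerrChartTransfer.stub_kerrChartTransfer 𝓑
      (hCCH 𝓑 LorentzianMetric.isOpen_chronologicalFuture_holds_of_boundaryless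
        LorentzianMetric.isOpen_chronologicalPast_holds_of_boundaryless
        PseudoRiemannianMetric.contMDiff_restrict_holds hreg hconn hvac hsc
        (a • 𝓑.killing + b • K') hΦon hΦc hper hax hΦnt (U ∩ U') ((-(b / a)) • K) (-a⁻¹)
        (-(b / a) * κ) hUU' hHUU' hχon hχeq hχne hχtan hκ' hχκ)

end Summit.FinalStateConjecture.FinalStateConjecture.Theorems.HawkingExtensionIsKerr.SketchIdeator2

end
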